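import Literature.Computability.Cryptography.VanDamSeroussiCubicDecode
import HarnessLib

/-!
# The quantum block of the cubic Gauss-sum experiment, VII: the signal of one component

Topic `Literature/Computability/Cryptography`; sequel of `VanDamSeroussiCubicDecode.lean`. For one
component `d = (p, r, c', τ)` of the block and a property `P` of frequencies, the statistic
"`P(c = 0, P(freqOf γ)) − P(c = 1, P(freqOf γ))`" of the block is, EXACTLY,

`S(P) = σ₀ · Re( ph · Σ_{f<N} w_P(f) · conj(S f) · R f )`, `σ₀ = (1/√2)ⁿ / (2^λ N)`,

with `S = dirichletSum`, `R = repFourier 1_{C_{c'}}`, `ph = 1` or `−i`, and `w_P(f)` the weight of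
the read-outs decoding into `P` under the law of frequency `f` — within `128κ/B` of `[P f]`
(`LAW₂`, `sigConst_eq`; van Dam–Seroussi 2002, §4, proof of Thm. 1, with the tree's Fourier-basis
read-out). Everything here is proved; no named fact is introduced.

## References

* W. van Dam, G. Seroussi, arXiv:quant-ph/0207131 (2002), §4 Thm. 1 (proof) [VanDamSeroussi2002].
* A. Yu. Kitaev, arXiv:quant-ph/9511026 (1995), §3, §5 [Kitaev1995].
-/

noncomputable section

namespace Literature.Computability.Cryptography

namespace VanDamSeroussi

namespace CubicBlock

open _root_.Computability Complexity QuantumComplexity Kitaev1995 Finset Complex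
open Literature.Computability.QuantumComplexity.QFTQubits

/-- Polarisation: `‖A + B‖² − ‖A − B‖² = 4 Re(conj A · B)`. [folklore] -/
theorem norm_sq_add_sub_norm_sq_sub (A B : ℂ) : ‖A + B‖ ^ 2 - ‖A - B‖ ^ 2 = 4 * ((starRingEnd ℂ) A * B).re := by
  rw [← Complex.normSq_eq_norm_sq, ← Complex.normSq_eq_norm_sq, Complex.normSq_add, Complex.normSq_sub]
  have : (A * (starRingEnd ℂ) B).re = ((starRingEnd ℂ) A * B).re := by
    rw [← Complex.conj_re (A * (starRingEnd ℂ) B), map_mul, Complex.conj_conj, mul_comm]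
  rw [this]; ring

/-- `invSqrt2` is real. [folklore] -/
theorem invSqrt2_eq_ofReal : (invSqrt2 : ℂ) = ((1 / Real.sqrt 2 : ℝ) : ℂ) := by
  rw [invSqrt2]; push_cast; rfl

namespace Layout

variable (Λ : Layout)

/-- The weight of the read-outs decoding into `P` under the law of frequency `f`. [folklore] -/
def wP (P : ℕ → Prop) [DecidablePred P] (f : ℕ) : ℝ := ∑ γ : QReg Λ.k, if P (Λ.freqOf γ) then ∏ j, Λ.wt f j (γ j) else 0

/-- The real constant `r₀` with `c₀ c₁ = r₀`. [folklore] -/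
def r₀ : ℝ := (1 / Real.sqrt 2) ^ (Λ.lam + 1) * (1 / Real.sqrt 2) ^ (Λ.n + Λ.lam + 1)

/-- `c₀ c₁ = r₀`. [folklore] -/
theorem c₀_mul_c₁ : Λ.c₀ * Λ.c₁ = ((Λ.r₀ : ℝ) : ℂ) := by
  rw [c₀, c₁, r₀, invSqrt2_eq_ofReal]; push_cast; ring

/-- **The signal constant** `σ₀ = 4 ‖2^{-1/2} K‖² r₀ 4^k / N`. [folklore] -/
def sigConst : ℝ := 4 * ‖invSqrt2 * Λ.K‖ ^ 2 * Λ.r₀ * 4 ^ Λ.k / Λ.Nmod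

/-- **`σ₀ = (1/√2)ⁿ / (2^λ N)`.** [folklore] -/
theorem sigConst_eq : Λ.sigConst = (1 / Real.sqrt 2) ^ Λ.n / (2 ^ Λ.lam * Λ.Nmod) := by
  have hsK : ‖invSqrt2 * Λ.K‖ ^ 2 = (1 / 2 : ℝ) ^ (2 * Λ.k + 1) := by
    rw [K, show invSqrt2 * (invSqrt2 ^ Λ.k * invSqrt2 ^ Λ.k) = invSqrt2 ^ (2 * Λ.k + 1) by ring, norm_invSqrt2_pow_sq]
  have h2 : (1 / Real.sqrt 2 : ℝ) ^ 2 = 1 / 2 := by rw [div_pow, one_pow, Real.sq_sqrt (by norm_num)]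
  have hr : Λ.r₀ = (1 / Real.sqrt 2) ^ Λ.n * (1 / 2 : ℝ) ^ (Λ.lam + 1) := by
    rw [r₀, ← h2, ← pow_mul, ← pow_add, ← pow_add]; congr 1; ring
  have hN : (0 : ℝ) < Λ.Nmod := by have := Λ.size_facts.1; exact_mod_cast (show 0 < Λ.Nmod by omega)
  have h4 : (4 : ℝ) ^ Λ.k = 2 ^ Λ.k * 2 ^ Λ.k := by rw [← mul_pow]; norm_num
  rw [sigConst, hsK, hr, h4]
  simp only [one_div, inv_pow]
  field_simp
  ring

/-- **The difference of the Born weights of a good label under the two controls** is the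
interference term `4 ‖2^{-1/2}K‖² r₀ Re(ph · conj(a₀) a₁)`. [cite: VanDamSeroussi2002, §3.1 Fact 2] -/
theorem amp_diff (d : Data) (γ : QReg Λ.k) (u : ℕ) :
    ‖Λ.amp d false γ u‖ ^ 2 - ‖Λ.amp d true γ u‖ ^ 2 =
      4 * ‖invSqrt2 * Λ.K‖ ^ 2 * Λ.r₀ * (ph d * ((starRingEnd ℂ) (Λ.a₀ d γ u) * Λ.a₁ d γ u)).re := by
  have hf : Λ.amp d false γ u = (invSqrt2 * Λ.K) * (Λ.c₀ * Λ.a₀ d γ u + ph d * Λ.c₁ * Λ.a₁ d γ u) := by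
    simp only [amp, Bool.false_eq_true, if_false]; ring
  have ht : Λ.amp d true γ u = (invSqrt2 * Λ.K) * (Λ.c₀ * Λ.a₀ d γ u - ph d * Λ.c₁ * Λ.a₁ d γ u) := by
    simp only [amp, if_true]; ring
  rw [hf, ht, norm_mul (invSqrt2 * Λ.K) (_ + _), norm_mul (invSqrt2 * Λ.K) (_ - _), mul_pow, mul_pow, ← mul_sub,
    norm_sq_add_sub_norm_sq_sub, map_mul,
    show (starRingEnd ℂ) Λ.c₀ * (starRingEnd ℂ) (Λ.a₀ d γ u) * (ph d * Λ.c₁ * Λ.a₁ d γ u) =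
      (Λ.c₀ * Λ.c₁) * (ph d * ((starRingEnd ℂ) (Λ.a₀ d γ u) * Λ.a₁ d γ u)) by
        rw [show (starRingEnd ℂ) Λ.c₀ = Λ.c₀ by rw [c₀, invSqrt2_eq_ofReal]; push_cast; simp [Complex.conj_ofReal]]; ring,
    Λ.c₀_mul_c₁, Complex.re_ofReal_mul]
  ring

/-- The weight `wP` as the decoded part of `Σ_γ ‖Mk f γ‖²`. [folklore] -/
theorem sum_ite_norm_sq_Mk (P : ℕ → Prop) [DecidablePred P] (f : ℕ) :
    ∑ γ : QReg Λ.k, (if P (Λ.freqOf γ) then (‖Λ.Mk f γ‖ ^ 2 : ℂ) else 0) = ((4 ^ Λ.k * Λ.wP P f : ℝ) : ℂ) := by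
  rw [wP, Finset.mul_sum]
  push_cast
  refine sum_congr rfl fun γ _ => ?_
  split_ifs
  · rw [← Complex.ofReal_pow, Λ.norm_sq_Mk_eq_prod]; push_cast; ring
  · simp

/-- **LAW₂ — the statistic of one component.** For a property `P` of the decoded frequency,
`P(c = 0, P) − P(c = 1, P) = σ₀ · Re( ph · Σ_{f<N} w_P(f) · conj(S f) · R f )` exactly, where
`w_P(f)` is the weight of decoding into `P` under the law of frequency `f`.
[cite: VanDamSeroussi2002, §4 Thm. 1 (proof)] [cite: Kitaev1995, §3, §5] -/
theorem LAW₂ {d : Data} (hd : Λ.DataOK d) (hp : 0 < d.p) (hgood : ∀ s ∈ Λ.goodS d, s < d.p)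
    (P : ℕ → Prop) [DecidablePred P] :
    Λ.Pb d false (fun γ => P (Λ.freqOf γ)) - Λ.Pb d true (fun γ => P (Λ.freqOf γ)) =
      Λ.sigConst * (ph d * ∑ f ∈ range Λ.Nmod, ((Λ.wP P f : ℝ) : ℂ) *
        ((starRingEnd ℂ) (dirichletSum Λ.Nmod (2 ^ Λ.lam) d.p f) * repFourier Λ.Nmod (2 ^ Λ.lam) d.p (Λ.indGood d) f)).re := by
  set cSR : ℕ → ℂ := fun f => (starRingEnd ℂ) (dirichletSum Λ.Nmod (2 ^ Λ.lam) d.p f) *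
    repFourier Λ.Nmod (2 ^ Λ.lam) d.p (Λ.indGood d) f with hcSR
  set Cst : ℝ := 4 * ‖invSqrt2 * Λ.K‖ ^ 2 * Λ.r₀ with hCst
  -- the interference term of one read-out, summed over the moved value
  set Z : QReg Λ.k → ℂ := fun γ => ph d * ∑ u ∈ range Λ.Nmod, (starRingEnd ℂ) (Λ.a₀ d γ u) * Λ.a₁ d γ u with hZ
  have hγ : ∀ γ : QReg Λ.k, ∑ u ∈ range Λ.Nmod, (‖Λ.amp d false γ u‖ ^ 2 - ‖Λ.amp d true γ u‖ ^ 2) = Cst * (Z γ).re := by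
    intro γ
    simp_rw [Λ.amp_diff, ← hCst]
    rw [← Finset.mul_sum, hZ]
    simp only
    conv_rhs => rw [Finset.mul_sum, Complex.re_sum]
  have hZsum : ∑ γ : QReg Λ.k, (if P (Λ.freqOf γ) then Z γ else 0) =
      ph d * ((Λ.Nmod : ℂ)⁻¹ * ∑ f ∈ range Λ.Nmod, ((4 ^ Λ.k * Λ.wP P f : ℝ) : ℂ) * cSR f) := by
    have h1 : ∀ γ : QReg Λ.k, (if P (Λ.freqOf γ) then Z γ else 0) =
        ph d * ((Λ.Nmod : ℂ)⁻¹ * ∑ f ∈ range Λ.Nmod, (if P (Λ.freqOf γ) then (‖Λ.Mk f γ‖ ^ 2 : ℂ) else 0) * cSR f) := by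
      intro γ
      split_ifs with h
      · rw [hZ]; simp only; rw [Λ.LAW₁ hgood]
      · simp
    simp_rw [h1]
    rw [← Finset.mul_sum, ← Finset.mul_sum, Finset.sum_comm]
    congr 2
    refine sum_congr rfl fun f _ => ?_
    rw [← Finset.sum_mul, Λ.sum_ite_norm_sq_Mk]
  rw [Λ.Pb_false_sub_Pb_true hd hp]
  have hL : ∑ γ : QReg Λ.k, ∑ u ∈ range Λ.Nmod, (if P (Λ.freqOf γ) then ‖Λ.amp d false γ u‖ ^ 2 - ‖Λ.amp d true γ u‖ ^ 2 else 0) =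
      ∑ γ : QReg Λ.k, Cst * (if P (Λ.freqOf γ) then Z γ else 0).re := by
    refine sum_congr rfl fun γ _ => ?_
    split_ifs with h
    · exact hγ γ
    · simp
  rw [hL, ← Finset.mul_sum, ← Complex.re_sum, hZsum, sigConst]
  -- pull the real factor `4^k / N` out of the real part
  have hre : (ph d * ((Λ.Nmod : ℂ)⁻¹ * ∑ f ∈ range Λ.Nmod, ((4 ^ Λ.k * Λ.wP P f : ℝ) : ℂ) * cSR f)).re =
      (4 ^ Λ.k / Λ.Nmod : ℝ) * (ph d * ∑ f ∈ range Λ.Nmod, ((Λ.wP P f : ℝ) : ℂ) * cSR f).re := by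
    rw [← Complex.re_ofReal_mul]
    congr 1
    rw [Finset.mul_sum, Finset.mul_sum, Finset.mul_sum, Finset.mul_sum]
    refine sum_congr rfl fun f _ => ?_
    push_cast
    field_simp
  rw [hre, hCst]
  ring

/-! ### The decoding error of the signal -/

/-- A Parseval sum over a set of distinct small values: `Σ_{f<N} |Σ_{v} e(v f/N)|² = N · |V|` when the
values `v a`, `a ∈ A`, are pairwise distinct and `< N`. [folklore] -/
theorem sum_norm_sq_sum_eR {α : Type*} [DecidableEq α] (A : Finset α) {N : ℕ} (hN : 0 < N) (v : α → ℕ) (hv : ∀ a ∈ A, v a < N)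
    (hinj : Set.InjOn v A) :
    ∑ f ∈ range N, ‖∑ a ∈ A, eR ((v a : ℝ) * f / N)‖ ^ 2 = N * A.card := by
  suffices h : (∑ f ∈ range N, (‖∑ a ∈ A, eR ((v a : ℝ) * f / N)‖ ^ 2 : ℂ)) = N * A.card by exact_mod_cast h
  calc (∑ f ∈ range N, (‖∑ a ∈ A, eR ((v a : ℝ) * f / N)‖ ^ 2 : ℂ))
      = ∑ f ∈ range N, ∑ a ∈ A, ∑ a' ∈ A, eR ((((v a : ℤ) - v a' : ℤ) : ℝ) * f / N) := by
        refine sum_congr rfl fun f _ => ?_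
        rw [← Complex.ofReal_pow, Complex.sq_norm, ← Complex.mul_conj, map_sum, Finset.sum_mul_sum]
        refine sum_congr rfl fun a _ => sum_congr rfl fun a' _ => ?_
        rw [conj_eR, ← eR_add]; congr 1; push_cast; ring
    _ = ∑ a ∈ A, ∑ a' ∈ A, ∑ f ∈ range N, eR ((((v a : ℤ) - v a' : ℤ) : ℝ) * f / N) := by
        rw [Finset.sum_comm]; refine sum_congr rfl fun a _ => ?_; rw [Finset.sum_comm]
    _ = ∑ a ∈ A, ∑ a' ∈ A, (if a = a' then (N : ℂ) else 0) := by
        refine sum_congr rfl fun a ha => sum_congr rfl fun a' ha' => ?_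
        rw [sum_eR_int_mul_div hN]
        by_cases haa : a = a'
        · subst haa; simp
        · rw [if_neg haa, if_neg]
          rintro ⟨c, hc⟩
          have h1 := hv a ha; have h2 := hv a' ha'
          have hne : v a ≠ v a' := fun h => haa (hinj ha ha' h)
          have habs : |(v a : ℤ) - v a'| < N := by rw [abs_lt]; constructor <;> omega
          rw [hc, abs_mul, abs_of_nonneg (by positivity : (0 : ℤ) ≤ N)] at habs
          have hc0 : c ≠ 0 := by rintro rfl; rw [mul_zero, sub_eq_zero] at hc; exact hne (by exact_mod_cast hc)
          have : (1 : ℤ) ≤ |c| := Int.one_le_abs hc0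
          nlinarith
    _ = N * A.card := by
        rw [show (∑ a ∈ A, ∑ a' ∈ A, (if a = a' then (N : ℂ) else 0)) = ∑ a ∈ A, (N : ℂ) from
          sum_congr rfl fun a ha => by rw [sum_ite_eq]; exact if_pos ha]
        simp [mul_comm]

/-- **Parseval for the transform of the coset indicator**: `Σ_{f<N} ‖R f‖² = N · 2^λ · |C|`
(the values `s + jp`, `s ∈ C`, `j < 2^λ`, are distinct residues). [folklore] -/
theorem sum_norm_sq_repFourier_indGood {d : Data} (hd : Λ.DataOK d) (hp : 0 < d.p) (hgood : ∀ s ∈ Λ.goodS d, s < d.p) :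
    ∑ f ∈ range Λ.Nmod, ‖repFourier Λ.Nmod (2 ^ Λ.lam) d.p (Λ.indGood d) f‖ ^ 2 = Λ.Nmod * (2 ^ Λ.lam * (Λ.goodS d).card) := by
  have hN : 0 < Λ.Nmod := by have := Λ.size_facts.1; omega
  -- the transform as one sum over `(s, j)`
  have hR : ∀ f, repFourier Λ.Nmod (2 ^ Λ.lam) d.p (Λ.indGood d) f =
      ∑ q ∈ Λ.goodS d ×ˢ range (2 ^ Λ.lam), eR (((q.1 + q.2 * d.p : ℕ) : ℝ) * f / Λ.Nmod) := by
    intro f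
    rw [repFourier, ← Finset.sum_filter_add_sum_filter_not (range d.p) (fun x => x ∈ Λ.goodS d),
      Finset.sum_eq_zero (s := (range d.p).filter fun x => x ∉ Λ.goodS d) (fun x hx => Finset.sum_eq_zero fun jv _ => by
        rw [indGood, if_neg (Finset.mem_filter.1 hx).2, zero_mul]), add_zero,
      show (range d.p).filter (fun x => x ∈ Λ.goodS d) = Λ.goodS d from
        Finset.ext fun x => by simp only [Finset.mem_filter, mem_range]; exact ⟨fun h => h.2, fun h => ⟨hgood x h, h⟩⟩,
      Finset.sum_product]
    refine sum_congr rfl fun s hs => sum_congr rfl fun jv _ => ?_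
    rw [indGood, if_pos hs, one_mul]; congr 1; push_cast; ring
  simp_rw [hR]
  rw [sum_norm_sq_sum_eR _ hN _ (fun q hq => ?_) (fun q hq q' hq' h => ?_), Finset.card_product, Finset.card_range]
  · push_cast; ring
  · obtain ⟨hs, hj⟩ := Finset.mem_product.1 hq
    have := Λ.lt_Nmod hd (lt_of_lt_of_le (hgood _ hs) hd.p_lt.le) (mem_range.1 hj)
    exact this
  · simp only [Finset.coe_product, Set.mem_prod, Finset.mem_coe, mem_range] at hq hq'
    have h1 := hgood _ hq.1; have h2 := hgood _ hq'.1
    -- `s + jp = s' + j'p` with `s, s' < p` forces `j = j'`, `s = s'`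
    have hj : q.2 = q'.2 := by
      by_contra hne
      rcases Nat.lt_or_gt_of_ne hne with hlt | hlt
      · have : q.1 + q.2 * d.p + d.p ≤ q'.2 * d.p := by nlinarith
        omega
      · have : q'.1 + q'.2 * d.p + d.p ≤ q.2 * d.p := by nlinarith
        omega
    have hs : q.1 = q'.1 := by rw [hj] at h; omega
    exact Prod.ext hs hj

/-- **The decoding error of the signal.** Replacing the decoding weights `w_P(f)` by the exact
indicator `[P f]` changes the statistic by at most `128 κ / B`: termwise `|w_P − [P]| ≤ 128κ/B`
(`abs_sum_decode_sub_le`), Cauchy–Schwarz, `Σ‖S‖² = 2^λ N`, `Σ‖R‖² = N 2^λ |C|`, `|C| ≤ 2ⁿ`.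
[cite: Kitaev1995, §3 Thm 1] [cite: VanDamSeroussi2002, §4 Thm. 1 (proof)] -/
theorem abs_signal_sub_le {d : Data} (hd : Λ.DataOK d) (hp : 0 < d.p) (hgood : ∀ s ∈ Λ.goodS d, s < d.p) (hB : 0 < Λ.B)
    (hLN : 2 ^ Λ.lam * d.p ≤ Λ.Nmod) (P : ℕ → Prop) [DecidablePred P] :
    |(Λ.Pb d false (fun γ => P (Λ.freqOf γ)) - Λ.Pb d true (fun γ => P (Λ.freqOf γ))) -
        Λ.sigConst * (ph d * ∑ f ∈ range Λ.Nmod, (if P f then (1 : ℂ) else 0) *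
          ((starRingEnd ℂ) (dirichletSum Λ.Nmod (2 ^ Λ.lam) d.p f) * repFourier Λ.Nmod (2 ^ Λ.lam) d.p (Λ.indGood d) f)).re|
      ≤ 128 * Λ.kap / Λ.B := by
  have hN : 0 < Λ.Nmod := by have := Λ.size_facts.1; omega
  set S : ℕ → ℂ := fun f => dirichletSum Λ.Nmod (2 ^ Λ.lam) d.p f with hS
  set R : ℕ → ℂ := fun f => repFourier Λ.Nmod (2 ^ Λ.lam) d.p (Λ.indGood d) f with hR
  set ε : ℝ := 128 * Λ.kap / Λ.B with hε
  have hε0 : 0 ≤ ε := by positivity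
  rw [Λ.LAW₂ hd hp hgood P, ← mul_sub, ← Complex.sub_re, ← mul_sub, ← Finset.sum_sub_distrib]
  simp_rw [← sub_mul]
  -- termwise bound `|wP f − [P f]| ‖S f‖ ‖R f‖`
  have hterm : ∀ f ∈ range Λ.Nmod, ‖((((Λ.wP P f : ℝ) : ℂ) - (if P f then 1 else 0)) * ((starRingEnd ℂ) (S f) * R f))‖ ≤
      ε * (‖S f‖ * ‖R f‖) := by
    intro f hf
    rw [norm_mul, norm_mul, Complex.norm_conj]
    refine mul_le_mul_of_nonneg_right ?_ (by positivity)
    have := Λ.abs_sum_decode_sub_le hB (mem_range.1 hf) P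
    rw [show (((Λ.wP P f : ℝ) : ℂ) - (if P f then 1 else 0)) = (((Λ.wP P f - (if P f then 1 else 0) : ℝ)) : ℂ) by
      push_cast; split_ifs <;> simp, Complex.norm_real, Real.norm_eq_abs]
    exact this
  have hsum : ‖∑ f ∈ range Λ.Nmod, (((Λ.wP P f : ℝ) : ℂ) - (if P f then 1 else 0)) * ((starRingEnd ℂ) (S f) * R f)‖ ≤
      ε * (Real.sqrt (2 ^ Λ.lam * Λ.Nmod) * Real.sqrt (Λ.Nmod * (2 ^ Λ.lam * (Λ.goodS d).card))) := by
    refine (norm_sum_le _ _).trans ((sum_le_sum hterm).trans ?_)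
    rw [← Finset.mul_sum]
    refine mul_le_mul_of_nonneg_left ?_ hε0
    have hCS := Real.sum_mul_le_sqrt_mul_sqrt (range Λ.Nmod) (fun f => ‖S f‖) (fun f => ‖R f‖)
    rw [show (∑ f ∈ range Λ.Nmod, ‖S f‖ ^ 2) = 2 ^ Λ.lam * Λ.Nmod from by
        rw [hS]; exact_mod_cast sum_norm_sq_dirichletSum hN hp hLN,
      show (∑ f ∈ range Λ.Nmod, ‖R f‖ ^ 2) = Λ.Nmod * (2 ^ Λ.lam * (Λ.goodS d).card) from by
        rw [hR]; exact_mod_cast Λ.sum_norm_sq_repFourier_indGood hd hp hgood] at hCS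
    exact hCS
  -- the real part is at most the norm; `ph` has norm `1`; the constant absorbs the square roots
  have hph : ‖ph d‖ = 1 := by rw [ph]; split_ifs <;> simp
  have hC : (Λ.goodS d).card ≤ 2 ^ Λ.n := by
    calc (Λ.goodS d).card ≤ (range (2 ^ Λ.n)).card := Finset.card_le_card (Finset.filter_subset _ _)
      _ = 2 ^ Λ.n := Finset.card_range _
  calc |Λ.sigConst * (ph d * ∑ f ∈ range Λ.Nmod, (((Λ.wP P f : ℝ) : ℂ) - (if P f then 1 else 0)) * ((starRingEnd ℂ) (S f) * R f)).re|
      ≤ Λ.sigConst * (ε * (Real.sqrt (2 ^ Λ.lam * Λ.Nmod) * Real.sqrt (Λ.Nmod * (2 ^ Λ.lam * (Λ.goodS d).card)))) := by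
        rw [abs_mul, abs_of_nonneg (show 0 ≤ Λ.sigConst by rw [Λ.sigConst_eq]; positivity)]
        refine mul_le_mul_of_nonneg_left ((Complex.abs_re_le_norm _).trans ?_) (by rw [Λ.sigConst_eq]; positivity)
        rw [norm_mul, hph, one_mul]; exact hsum
    _ = ε * ((1 / Real.sqrt 2) ^ Λ.n * Real.sqrt ((Λ.goodS d).card)) := by
        rw [Λ.sigConst_eq]
        have h2L : (0 : ℝ) < 2 ^ Λ.lam := by positivity
        have hNr : (0 : ℝ) < Λ.Nmod := by exact_mod_cast hN
        rw [show Real.sqrt (2 ^ Λ.lam * Λ.Nmod) * Real.sqrt (Λ.Nmod * (2 ^ Λ.lam * (Λ.goodS d).card)) =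
            2 ^ Λ.lam * Λ.Nmod * Real.sqrt ((Λ.goodS d).card) by
          rw [← Real.sqrt_mul (by positivity), show (2 : ℝ) ^ Λ.lam * Λ.Nmod * (Λ.Nmod * (2 ^ Λ.lam * (Λ.goodS d).card)) =
            (2 ^ Λ.lam * Λ.Nmod) ^ 2 * (Λ.goodS d).card by ring, Real.sqrt_mul (by positivity), Real.sqrt_sq (by positivity)]]
        field_simp
    _ ≤ ε * 1 := by
        refine mul_le_mul_of_nonneg_left ?_ hε0
        rw [div_pow, one_pow, one_div, inv_mul_le_iff₀ (by positivity), mul_one]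
        calc Real.sqrt ((Λ.goodS d).card) ≤ Real.sqrt (2 ^ Λ.n) := Real.sqrt_le_sqrt (by exact_mod_cast hC)
          _ = Real.sqrt 2 ^ Λ.n := by
              rw [show (2 : ℝ) ^ Λ.n = (Real.sqrt 2 ^ Λ.n) ^ 2 by rw [← pow_mul, mul_comm, pow_mul, Real.sq_sqrt (by norm_num)],
                Real.sqrt_sq (by positivity)]
    _ = ε := mul_one ε

end Layout



end CubicBlock

end VanDamSeroussi

end Literature.Computability.Cryptography
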